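import Mathlib
import Summits.RiemannHypothesis.RiemannHypothesis.Theorems.RuelleBandCofiniteCriticalLineStubZeroLevelNullVectorAux
import Summits.RiemannHypothesis.RiemannHypothesis.Theorems.RuelleBandCofiniteCriticalLineStubZeroLevelNullVectorAux3
import Literature.NumberTheory.LFunctions.WeilSemilocalCompactnessProofs
import Literature.NumberTheory.LFunctions.WeilWindowSimpleEven
import Literature.NumberTheory.LFunctions.WeilExplicitProofs
import HarnessLib

/-!
# Stub `stub_zeroLevelNullVector`, helper file 4/5: the abstract attainment theorem, transfer of level sets; the core submodule
(item stmt-RiemannHypothesis-2064, route route-RiemannHypothesis-RuelleBand; registered stub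
`stub_zeroLevelNullVector` of line `cofinite-weil-index-staircase` — "a zero min–max level of the
window form is a null vector", the attainment half of the crossing lemma).

* `stub_zeroLevelNullVector_abstract` — **"a zero min–max level over a form core is an
  eigenvalue"**, operator-free: `W` pre-Hilbert (form core with the form inner product), `H` Hilbert,
  `T : W →L[ℂ] H` injective with the sequential compact-embedding property, `N + 1` linearly
  independent core vectors; if the `N`-th Courant–Fischer level of `‖x‖² - C‖T x‖²` over linearly
  independent `(N+1)`-tuples of `W` is `0`, then there are `v ∈ H`, `v ≠ 0`, and core `xₙ` with
  `T xₙ → v`, `(xₙ)` form-Cauchy, `⟪h, xₙ⟫ - C⟪T h, T xₙ⟫ → 0` for all `h ∈ W`. Proof: spectral data of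
  the compact Gram operator of the extension (file 1/5), the two Courant–Fischer halves (files 2–3/5)
  to locate a level `1 - Cκᵢ = 0`, and extraction (file 3/5).
* `stub_zeroLevelNullVector_outer_transfer`: rewriting the level set of tuples of FUNCTIONS
  (membership predicate, `Σ cᵢ gᵢ(t)`, functionals `nsq`, `Qre`) as the abstract level set of core
  tuples along an injective linear evaluation map.
* Weil layer (registered sub-goal `stub_zeroLevelNullVector_exists_submodule`): the window test
  functions as a `ℂ`-submodule of `ℝ → ℂ`.

No definitions, no named facts. References: Reed–Simon IV, Thm. XIII.64 and XIII.1–2; Kato VI §2.1.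
-/

set_option linter.dupNamespace false -- justified: the module path repeats `RiemannHypothesis` (summit = problem); header prescribed by the line lead

noncomputable section

open Complex MeasureTheory Filter Set
open scoped BigOperators Topology ComplexConjugate InnerProductSpace

namespace Summit.RiemannHypothesis.RiemannHypothesis.Theorems.RuelleBandCofiniteCriticalLine

open Literature.NumberTheory.LFunctions

section AbstractLayer

variable {W : Type*} [NormedAddCommGroup W] [InnerProductSpace ℂ W]
variable {H : Type*} [NormedAddCommGroup H] [InnerProductSpace ℂ H] [CompleteSpace H]

section Main

/-- **Abstract attainment theorem ("a zero min–max level over a form core is an eigenvalue").**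
Let `W` be a pre-Hilbert space (the form core with the form inner product), `H` a Hilbert space,
`T : W → H` bounded and injective, with the sequential compactness property of the form embedding
(every `T`-normalised `W`-bounded sequence has a `T`-convergent subsequence). If the `N`-th
Courant–Fischer level of the form `‖x‖² - C ‖T x‖²` over linearly independent `(N+1)`-tuples of `W`
(normalised by `‖T ·‖ = 1`) is exactly `0`, then the closed form has a non-zero null vector, seen
from the core: `T xₙ → v ≠ 0`, `(xₙ)` form-Cauchy, `⟪h, xₙ⟫ - C⟪T h, T xₙ⟫ → 0` for every `h ∈ W`.
(Reed–Simon IV, Thm. XIII.64 with XIII.1–2; Kato VI §2.1.) [folklore] -/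
theorem stub_zeroLevelNullVector_abstract (T : W →L[ℂ] H) (C : ℝ) (N : ℕ)
    (hTinj : Function.Injective T)
    (hcomp : ∀ (x : ℕ → W) (M : ℝ), (∀ n, ‖T (x n)‖ = 1) → (∀ n, ‖x n‖ ≤ M) →
      ∃ (v : H) (φ : ℕ → ℕ), StrictMono φ ∧ Tendsto (fun n => T (x (φ n))) atTop (𝓝 v))
    (hdim : ∃ y : Fin (N + 1) → W, LinearIndependent ℂ y)
    (hlevel : sInf {x : ℝ | ∃ y : Fin (N + 1) → W, LinearIndependent ℂ y ∧
        x = sSup {r : ℝ | ∃ c : Fin (N + 1) → ℂ, ‖T (∑ i, c i • y i)‖ ^ 2 = 1 ∧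
          r = ‖∑ i, c i • y i‖ ^ 2 - C * ‖T (∑ i, c i • y i)‖ ^ 2}} = 0) :
    ∃ (v : H) (x : ℕ → W), v ≠ 0 ∧ Tendsto (fun n => T (x n)) atTop (𝓝 v) ∧
      Tendsto (fun q : ℕ × ℕ => ‖x q.1 - x q.2‖ ^ 2 - C * ‖T (x q.1 - x q.2)‖ ^ 2) atTop (𝓝 0) ∧
      ∀ h : W, Tendsto (fun n => ⟪h, x n⟫_ℂ - C * ⟪T h, T (x n)⟫_ℂ) atTop (𝓝 0) := by
  classical
  set Th := T.extend (UniformSpace.Completion.toComplL : W →L[ℂ] UniformSpace.Completion W)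
    with hThdef
  have hTh : ∀ x : W, Th x = T x := stub_zeroLevelNullVector_extend_coe T
  have hThc : IsCompactOperator Th := stub_zeroLevelNullVector_isCompactOperator_extend T hcomp
  obtain ⟨s, b, κ, hκ0, hκle, hκlim, hk4, hk5, hk6⟩ :=
    stub_zeroLevelNullVector_spectralData Th hThc
  set Outer : Set ℝ := {x : ℝ | ∃ y : Fin (N + 1) → W, LinearIndependent ℂ y ∧
        x = sSup {r : ℝ | ∃ c : Fin (N + 1) → ℂ, ‖T (∑ i, c i • y i)‖ ^ 2 = 1 ∧
          r = ‖∑ i, c i • y i‖ ^ 2 - C * ‖T (∑ i, c i • y i)‖ ^ 2}} with hOuter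
  have hne : Outer.Nonempty := by
    obtain ⟨y₀, hy₀⟩ := hdim
    exact ⟨_, y₀, hy₀, rfl⟩
  have hbdd : BddBelow Outer := by
    refine ⟨-C, ?_⟩
    rintro x ⟨y, hy, rfl⟩
    obtain ⟨hne', hba, hlow⟩ := stub_zeroLevelNullVector_inner_nonempty_bddAbove T C hTinj hy
    obtain ⟨r₀, hr₀⟩ := hne'
    exact (hlow r₀ hr₀).trans (le_csSup hba hr₀)
  by_cases hnull : ∃ i, 1 - C * κ i = 0
  · -- a null level: `b i` is a null vector of the closed form
    obtain ⟨i, hi⟩ := hnull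
    refine stub_zeroLevelNullVector_extract T C Th hTh (e := b i) (fun z => ?_) ?_
    · have h1 : ⟪Th z, Th (b i)⟫_ℂ = (κ i : ℂ) * ⟪z, b i⟫_ℂ := by
        rw [← inner_conj_symm, hk4, map_mul, Complex.conj_ofReal, inner_conj_symm]
      rw [h1]
      calc ⟪z, b i⟫_ℂ - (C : ℂ) * ((κ i : ℂ) * ⟪z, b i⟫_ℂ)
          = ((1 - C * κ i : ℝ) : ℂ) * ⟪z, b i⟫_ℂ := by push_cast; ring
        _ = 0 := by rw [hi, Complex.ofReal_zero, zero_mul]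
    · intro h0
      have h1 := hk4 i (b i)
      rw [h0, inner_zero_left, inner_self_eq_norm_sq_to_K, b.orthonormal.1 i] at h1
      have h2 : (κ i : ℂ) = 0 := by simpa using h1.symm
      have h3 : κ i = 0 := by exact_mod_cast h2
      rw [h3, mul_zero, sub_zero] at hi
      exact one_ne_zero hi
  · push Not at hnull
    exfalso
    -- the finite exceptional set and the negative levels
    have hfin : {i : s | ¬ (|C * κ i| < 1 / 2)}.Finite := by
      have ht : Tendsto (fun i => C * κ i) cofinite (𝓝 0) := by
        simpa using hκlim.const_mul C
      have hev := Metric.tendsto_nhds.1 ht (1 / 2) (by norm_num)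
      simp only [dist_zero_right, Real.norm_eq_abs] at hev
      exact Filter.eventually_cofinite.1 hev
    set E : Finset s := hfin.toFinset with hE
    have hEmem : ∀ i, i ∈ E ↔ ¬ (|C * κ i| < 1 / 2) := fun i => by
      rw [hE, Set.Finite.mem_toFinset]; rfl
    set Neg : Finset s := E.filter (fun i => 1 - C * κ i < 0) with hNeg
    have hNeg_mem : ∀ i, i ∈ Neg ↔ 1 - C * κ i < 0 := fun i => by
      rw [hNeg, Finset.mem_filter, hEmem]
      constructor
      · exact fun h => h.2
      · intro h
        refine ⟨fun habs => ?_, h⟩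
        have := (abs_lt.1 habs).2
        linarith
    by_cases hcard : N + 1 ≤ Neg.card
    · obtain ⟨I, hIsub, hIcard⟩ := Finset.exists_subset_card_eq hcard
      obtain ⟨y, hy, hlt⟩ := stub_zeroLevelNullVector_claimA T C hTinj Th hTh b κ hk4 I hIcard
        (fun i hi => (hNeg_mem i).1 (hIsub hi))
      have h0 : (0 : ℝ) ≤ sSup {r : ℝ | ∃ c : Fin (N + 1) → ℂ, ‖T (∑ i, c i • y i)‖ ^ 2 = 1 ∧
          r = ‖∑ i, c i • y i‖ ^ 2 - C * ‖T (∑ i, c i • y i)‖ ^ 2} := by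
        rw [← hlevel]
        exact csInf_le hbdd ⟨y, hy, rfl⟩
      linarith
    · push Not at hcard
      -- a uniform positive lower bound `m` off `Neg`
      set τ : ℝ := ‖Th‖ ^ 2 with hτ
      set F : Finset s := E.filter (fun i => ¬ (1 - C * κ i < 0)) with hF
      set vals : Finset ℝ := insert (1 / 2 : ℝ) (F.image fun i => 1 - C * κ i) with hvals
      have hvals_ne : vals.Nonempty := Finset.insert_nonempty _ _
      set m₀ : ℝ := vals.min' hvals_ne with hm₀
      have hm₀pos : 0 < m₀ := by
        refine (Finset.lt_min'_iff _ _).2 fun v hv => ?_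
        rw [hvals, Finset.mem_insert, Finset.mem_image] at hv
        rcases hv with rfl | ⟨i, hi, rfl⟩
        · norm_num
        · rw [hF, Finset.mem_filter] at hi
          have h1 : 0 ≤ 1 - C * κ i := not_lt.1 hi.2
          exact lt_of_le_of_ne h1 (hnull i).symm
      have hm₀le_half : m₀ ≤ 1 / 2 := Finset.min'_le _ _ (Finset.mem_insert_self _ _)
      have hm₀le : ∀ i ∈ F, m₀ ≤ 1 - C * κ i := fun i hi =>
        Finset.min'_le _ _ (Finset.mem_insert_of_mem (Finset.mem_image_of_mem _ hi))
      set m : ℝ := m₀ / (τ + 1) with hm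
      have hτ0 : 0 ≤ τ := by positivity
      have hmpos : 0 < m := by positivity
      have hmbound : ∀ i, i ∉ Neg → m * κ i ≤ 1 - C * κ i := fun i hi => by
        have h1 : m * κ i ≤ m₀ := by
          have h2 : m * κ i ≤ m * (τ + 1) :=
            mul_le_mul_of_nonneg_left ((hκle i).trans (by linarith)) hmpos.le
          have h3 : m * (τ + 1) = m₀ := by
            rw [hm]; field_simp
          linarith
        by_cases hiE : i ∈ E
        · have hiF : i ∈ F := by
            rw [hF, Finset.mem_filter]
            exact ⟨hiE, fun h => hi ((hNeg_mem i).2 h)⟩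
          exact h1.trans (hm₀le i hiF)
        · rw [hEmem, not_not] at hiE
          have := (abs_lt.1 hiE).2
          linarith
      -- every level is `≥ m`, contradicting `level = 0`
      have hall : ∀ x ∈ Outer, m ≤ x := by
        rintro x ⟨y, hy, rfl⟩
        obtain ⟨r, hr, hmr⟩ := stub_zeroLevelNullVector_claimB T C hTinj Th hTh b κ hk5 hk6 Neg
          (Nat.lt_succ_iff.1 hcard) hmbound hy
        obtain ⟨-, hba, -⟩ := stub_zeroLevelNullVector_inner_nonempty_bddAbove T C hTinj hy
        exact le_csSup_of_le hba hr hmr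
      have hle : m ≤ sInf Outer := le_csInf hne hall
      rw [hlevel] at hle
      linarith


end Main

/-! ### Transfer of the level sets along an injective evaluation map -/

section Transfer

omit [CompleteSpace H] in
/-- The inner level set of a core tuple, written through an injective linear "evaluation" map
`ev : W → (ℝ → ℂ)` and functionals `nsq`, `Qre` on functions that restrict to `‖T ·‖²` and to the
form `‖·‖² - C ‖T ·‖²` on the core, is the abstract inner level set. [folklore] -/
theorem stub_zeroLevelNullVector_inner_transfer (T : W →L[ℂ] H) (C : ℝ) {N : ℕ}
    (ev : W →ₗ[ℂ] (ℝ → ℂ)) (Qre nsq : (ℝ → ℂ) → ℝ)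
    (hQ : ∀ x, Qre (ev x) = ‖x‖ ^ 2 - C * ‖T x‖ ^ 2) (hn : ∀ x, nsq (ev x) = ‖T x‖ ^ 2)
    (y : Fin (N + 1) → W) :
    {r : ℝ | ∃ c : Fin (N + 1) → ℂ, nsq (fun t => ∑ i, c i * ev (y i) t) = 1 ∧
        r = Qre (fun t => ∑ i, c i * ev (y i) t)} =
    {r : ℝ | ∃ c : Fin (N + 1) → ℂ, ‖T (∑ i, c i • y i)‖ ^ 2 = 1 ∧
        r = ‖∑ i, c i • y i‖ ^ 2 - C * ‖T (∑ i, c i • y i)‖ ^ 2} := by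
  have hsum : ∀ c : Fin (N + 1) → ℂ, (fun t => ∑ i, c i * ev (y i) t) = ev (∑ i, c i • y i) := by
    intro c
    funext t
    rw [map_sum, Finset.sum_apply]
    refine Finset.sum_congr rfl fun i _ => ?_
    rw [map_smul, Pi.smul_apply, smul_eq_mul]
  ext r
  simp only [Set.mem_setOf_eq, hsum, hQ, hn]

omit [CompleteSpace H] in
/-- **Transfer of the Courant–Fischer level set.** With `ev`, `nsq`, `Qre` as above and a predicate
`P` characterising the range of `ev`, the level set over `P`-tuples of functions equals the
abstract level set over core tuples. [folklore] -/
theorem stub_zeroLevelNullVector_outer_transfer (T : W →L[ℂ] H) (C : ℝ) {N : ℕ}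
    (ev : W →ₗ[ℂ] (ℝ → ℂ)) (hev : Function.Injective ev) (P : (ℝ → ℂ) → Prop)
    (hP : ∀ g, P g ↔ ∃ x, ev x = g) (Qre nsq : (ℝ → ℂ) → ℝ)
    (hQ : ∀ x, Qre (ev x) = ‖x‖ ^ 2 - C * ‖T x‖ ^ 2) (hn : ∀ x, nsq (ev x) = ‖T x‖ ^ 2) :
    {x : ℝ | ∃ g : Fin (N + 1) → ℝ → ℂ, (∀ i, P (g i)) ∧ LinearIndependent ℂ g ∧
        x = sSup {r : ℝ | ∃ c : Fin (N + 1) → ℂ, nsq (fun t => ∑ i, c i * g i t) = 1 ∧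
          r = Qre (fun t => ∑ i, c i * g i t)}} =
    {x : ℝ | ∃ y : Fin (N + 1) → W, LinearIndependent ℂ y ∧
        x = sSup {r : ℝ | ∃ c : Fin (N + 1) → ℂ, ‖T (∑ i, c i • y i)‖ ^ 2 = 1 ∧
          r = ‖∑ i, c i • y i‖ ^ 2 - C * ‖T (∑ i, c i • y i)‖ ^ 2}} := by
  have hker : LinearMap.ker ev = ⊥ := LinearMap.ker_eq_bot.2 hev
  ext x
  simp only [Set.mem_setOf_eq]
  constructor
  · rintro ⟨g, hg, hli, rfl⟩
    have hy : ∀ i, ∃ y : W, ev y = g i := fun i => (hP (g i)).1 (hg i)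
    choose y hy using hy
    have hgy : g = fun i => ev (y i) := funext fun i => (hy i).symm
    refine ⟨y, ?_, ?_⟩
    · refine LinearIndependent.of_comp ev ?_
      rw [hgy] at hli
      exact hli
    · rw [hgy, stub_zeroLevelNullVector_inner_transfer T C ev Qre nsq hQ hn y]
  · rintro ⟨y, hli, rfl⟩
    refine ⟨fun i => ev (y i), fun i => (hP _).2 ⟨y i, rfl⟩, ?_, ?_⟩
    · exact (LinearMap.linearIndependent_iff ev hker).2 hli
    · rw [stub_zeroLevelNullVector_inner_transfer T C ev Qre nsq hQ hn y]

end Transfer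

end AbstractLayer

/-! ### The core of the window as a submodule -/

section CoreSubmodule

/-- The window test functions form a `ℂ`-subspace of `ℝ → ℂ`. [folklore] -/
theorem stub_zeroLevelNullVector_exists_submodule :
    ∀ a : ℝ, ∃ V : Submodule ℂ (ℝ → ℂ), ∀ g, g ∈ V ↔ IsWeilTest g ∧ tsupport g ⊆ Set.Icc (-a) a := by
  intro a
  refine ⟨{ carrier := {g | IsWeilTest g ∧ tsupport g ⊆ Set.Icc (-a) a}
            add_mem' := fun {g h} hg hh => ⟨hg.1.add hh.1,
              (tsupport_add g h).trans (Set.union_subset hg.2 hh.2)⟩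
            zero_mem' := ⟨⟨contDiff_const, HasCompactSupport.zero⟩, by simp⟩
            smul_mem' := fun c g hg => ⟨hg.1.const_mul c,
              (tsupport_mul_subset_right (f := fun _ : ℝ => c) (g := g)).trans hg.2⟩ },
    fun g => Iff.rfl⟩

end CoreSubmodule

end Summit.RiemannHypothesis.RiemannHypothesis.Theorems.RuelleBandCofiniteCriticalLine

end
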